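import Literature.MathematicalPhysics.QuantumFieldTheory.Balaban1983to89.B15
import Literature.MathematicalPhysics.QuantumFieldTheory.Balaban1983to89.Step

/-!
# `Balaban1983to89.B15.BasicStep` — B15 §0–§1: the normalization (0.3)/(0.4), (1.100)/(1.102) of the 𝐑 operation as
a kernel-checked identity over `Setup.fieldMeasure`; verbatim leaves of §1; kernel arithmetic of the printed chains

CITATION HEADER (lean-in-tree rule 2026-08-18). T. Bałaban, *Large field renormalization. I. The basic step of the 𝐑
operation*, Comm. Math. Phys. **122**, 175–202 (1989) [Balaban1989LargeFieldI] (cell paper B15 = primary P15; PDF held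
`paper:balaban1989-cmp122-large-field-i`, journal page = PDF page + 174; every quotation below was checked against the
page renders, not the OCR).  The paper is a manuscript UNDER ADJUDICATION by the audit cell `pub-balaban`; nothing of it
is asserted here as a fact: the `def … : Prop`/`ℝ` leaves of Part B are verbatim transcriptions (docstring = quotation +
page), and every `theorem` is either bookkeeping over those leaves, elementary measure theory (Mathlib `lmarginal` over a
finite product of probability spaces), or real arithmetic — proved here, no `sorry`, no new axioms.  Sibling of
`…Balaban1983to89.B15` (unit r2: `RData`, `Rop`, `Normalization04`, `Prop1Printed`, `Ineq180`), which it imports and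
does not modify; the abstract scalar `RData.IntOver` there is made concrete here (DIVERGENCE D-b01.1).

WHAT IS PRINTED. §0, p. 176: (0.3) *"(ℝρ)(V) = Σ_Z ρ(Z″, V) ∫dV⌈_{Z′} ρ(Z, V) / ∫dV⌈_{Z′} ρ(Z″, V)"* (the sum over
the admissible `Z = (Z′, Z″)` of (0.2), `Z′` the new large-field region whose field variables are integrated out);
*"We will prove that the densities are positive, and the in[t]egration domains in the integrals above are nonempty,
hence the denominators are positive"*; (0.4) *"∫dV(ℝρ)(V) = ∫dVρ(V)"*.  §1, pp. 201–202: (1.100) the new density =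
(the old large-field expression with the `Λ_i`-terms integrated) × the normalization factors
`∫dV_k⌈ χ(Λ_i)…ρ′ / ∫dV_k⌈ χ(Λ_i)…ρ″`, (1.101) the small-field condition defining `χ(Λ_i)`, and (1.102)
*"∫dV_k ρ′_k(V_k) = ∫dV_k ρ_k(V_k)"*, with the mechanism stated on p. 193 (*"equivalence means that both sides have
equal integrals over the space of fields V_k"*) and p. 194 (*"the integration over Λ … is independent of V_k⌈_Λ, …
equivalent to the sum of the new, integrated terms"*).  §1, pp. 181–200: the inductive characteristic functions
(1.24), the implication (1.29) "new restrictions ⇒ old restrictions" proved on pp. 183–187 through the chains (1.31),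
(1.43), (1.47)–(1.52), the regularity factor (1.64)(i), the flow remarks of p. 192, the bounds (1.83), (1.84), (1.87),
the second implication (1.89) sketched on pp. 198–200 through (1.94), (1.96), (1.98).

WHAT THIS FILE TYPES AND PROVES.
* Part A (generic; `ι`-indexed product of measure spaces, `∫⋯∫⁻_s, f ∂μ` = the paper's `∫dV⌈_{Z′}`): `IndepOf`
  ("a function of `V⌈_{Z′ᶜ}`"), `lmarginal_mul_of_indepOf`, `lmarginal_of_indepOf`, `lmarginal_lmarginal_self`
  (integrating the `Λ`-variables twice = once: the p. 194 mechanism), `lmarginal_ratio_term`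
  (`∫_s den·(∫_s num / ∫_s den) = ∫_s num` when `0 < ∫_s den < ∞` — the one-line reason for (0.4)/(1.102)),
  `Rop03` = the printed right side of (0.3) (`fib Z = Z′`, `pp Z = Z″`), `lintegral_rop03` = (0.4) PROVED from
  exactly the printed provisos (measurability; denominators `≠ 0`, `≠ ∞`), `lmarginal_rop03` (its fibrewise form).
* Part A2 (over `Setup`; `fieldMeasure P j G = Measure.pi (Haar)` holds by `rfl`): `fibreIntegral`, `normTerm`
  (one term `new·(∫⌈old / ∫⌈new)` of (0.3)/(1.100)), `integral_normTerm_eq` = (1.102) for one term, PROVED for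
  measurable, nonnegative, bounded real densities whose NEW fibre integral vanishes nowhere; `RopReal`,
  `integral_ropReal_eq` = (0.4) over `Setup`; `Eq1102`, `preservesIntegral_iff_eq1102`, and
  `preservesIntegral_of_rop`: the hypothesis `PreservesIntegral (D.R k)` of `Step.DensityRG.integral_invariant`
  (cell STEP.md §10 item 7) holds for every operation that acts on each density either as the identity or as such an
  𝐑-sum — so the ONLY non-definitional input consumed there is the non-vanishing of the denominators, i.e. B15's
  announced and deferred *"the densities are positive … domains … nonempty"* (p. 176; positivity/analyticity is the
  business of Proposition 1 = [II]) — census row GAPS.md G-B15-01 / C-B15-01.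
* Part B (verbatim leaves, schematic real parameters — DIVERGENCE D-b01.3): `SF149`/`SF151` ((1.24), (1.49), (1.51)),
  `Ineq148`, `coeff152`, `Claim129`/`Claim189` with `claim129_iff_indicator` (the printed equality of products of
  characteristic functions ↔ the implication), `expr131a`/`coeff131`, `Ineq157`, `lfFactor` ((1.64)(i)),
  `Ineq183`/`Ineq184`/`Ineq187`, `RestrN194`, `Ineq196`, `expr198`, `Chi101`, `Nwt` (`= 1/384` in `d = 4`).
* Part C (kernel arithmetic of the printed chains; each number also reproduced in exact rational arithmetic by the
  cell, census rows C-B15-nn): `coeff131_lt_one`, `expr131a_le` ((1.31) middle step needs the unprinted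
  `ε_jξ ≤ L^{−2}`), `sqrt_exp_estimate` (p. 186), `ineq150`, `coeff150_eq`,
  `coeff150_le_coeff149_iff` (*"implies (1.49) if 8α ≤ 1"* — an IFF), `sf149_step` (the inductive step assembled),
  `coeff152_lt_one` (*"under the usual restrictions … β₀ ≤ 1/2, β ≤ 1/2, L₀ < L/2, and α ≤ 1/4"*), `ineq152_middle`,
  `ineq143_iff`, `sum_half_pow_succ_lt_one`, `lfFactor_witness` (the p. 182 example `β = 1/2` makes the (1.64)(i)
  factor NEGATIVE, `−9/16` at `(h,j,m,k) = (0,4,2,5)`; `7/32` at `β = 1/4` — G-B15-02), `l0_example_violates`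
  (p. 182 `L₀ = (L−1)/2` vs p. 191 `L₀² ≤ L/3`), `params_instance` (a consistent choice), `n0_delta_bound`, `n0_growth`
  (p. 192), `coeff196`, `expr198_le`, `bound200a`/`bound200b`/`bound200c` (p. 200), `restrN194_exponent`.

NOT TYPED HERE: Proposition 1 (p. 195; proved only in [II]) and (1.80) — unit r2's `B15.Prop1Printed`, `B15.Ineq180`;
the inductive geometry (1.6)–(1.23) of the regions `Z_j, Z″_j, Ω_j, Λ` (cell STEP.md §7); positivity / analyticity of
the effective densities ([II], [16]).  Unit `b2b-balaban-b01` (fallback seat, PHASE-2 row P15).  Census: GAPS.md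
G-B15-01…, C-B15-01…; DIVERGENCE.md D-b01.1–3; SMALLNESS.md (B15 rows).
-/

open scoped BigOperators ENNReal
open _root_.MeasureTheory Function Finset

namespace Literature.MathematicalPhysics.QuantumFieldTheory.Balaban1983to89.B15.BasicStep

/-! ## Part A. The normalization mechanism of (0.3)/(0.4) and (1.100)/(1.102), concretely, over a finite product of
measure spaces (`MeasureTheory.lmarginal` = the paper's `∫dV⌈_{Z′}`). -/

section Fibre

variable {ι : Type*} [DecidableEq ι] {X : ι → Type*} [∀ i, MeasurableSpace (X i)]
  (μ : ∀ i, Measure (X i))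

/-- `IndepOf s f`: the function `f` of all the variables does not depend on the variables indexed by `s`
("a function of `V⌈_{Z′ᶜ}`", p. 176; p. 194 "independent of V_k⌈_Λ"). [cite: Balaban1989LargeFieldI, (0.3) p.176] -/
def IndepOf (s : Finset ι) (f : (∀ i, X i) → ℝ≥0∞) : Prop :=
  ∀ (x : ∀ i, X i) (y : ∀ i : s, X i), f (updateFinset x s y) = f x

/-- The fibre integral `∫dV⌈_{Z′}` (Mathlib `lmarginal`) is a function of the remaining variables only. [folklore] -/
theorem indepOf_lmarginal (s : Finset ι) (f : (∀ i, X i) → ℝ≥0∞) : IndepOf s (∫⋯∫⁻_s, f ∂μ) := by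
  intro x y
  apply lmarginal_congr
  intro i hi
  simp [updateFinset, hi]

variable {μ} in
/-- A factor independent of the fibre variables pulls out of the fibre integral. [folklore] -/
theorem lmarginal_mul_of_indepOf (s : Finset ι) {f g : (∀ i, X i) → ℝ≥0∞} (hf : IndepOf s f)
    (hg : Measurable g) : ∫⋯∫⁻_s, f * g ∂μ = f * ∫⋯∫⁻_s, g ∂μ := by
  ext x
  simp only [lmarginal, Pi.mul_apply]
  simp_rw [hf x]
  exact lintegral_const_mul _ (hg.comp measurable_updateFinset)

variable {μ} in
/-- Over PROBABILITY fibres (normalized Haar measures, p. 176) a fibre-independent function is its own fibre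
integral. [folklore] -/
theorem lmarginal_of_indepOf [∀ i, IsProbabilityMeasure (μ i)] (s : Finset ι) {f : (∀ i, X i) → ℝ≥0∞}
    (hf : IndepOf s f) : ∫⋯∫⁻_s, f ∂μ = f := by
  ext x
  simp only [lmarginal]
  simp_rw [hf x]
  simp

/-- IDEMPOTENCE of fibre integration over probability fibres — the Λ-integration step of p. 194 ("an integration
of this term with respect to the field variables V_k over the domain Λ … a new expression … independent of
V_k⌈_Λ"): integrating the integrated term again over the same fibre changes nothing. [folklore] -/
theorem lmarginal_lmarginal_self [∀ i, IsProbabilityMeasure (μ i)] (s : Finset ι)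
    (f : (∀ i, X i) → ℝ≥0∞) : ∫⋯∫⁻_s, (∫⋯∫⁻_s, f ∂μ) ∂μ = ∫⋯∫⁻_s, f ∂μ :=
  lmarginal_of_indepOf s (indepOf_lmarginal μ s f)

/-- Hence the Λ-integration step preserves TOTAL integrals (p. 193 l.−9: "the equivalence means that both sides
have equal integrals over the space of fields V_k"; p. 194 "the density is equivalent to the sum of the new,
integrated terms"). [cite: Balaban1989LargeFieldI, p.194 ll.1–4] -/
theorem lintegral_lmarginal_eq [Fintype ι] [∀ i, IsProbabilityMeasure (μ i)] (s : Finset ι)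
    {f : (∀ i, X i) → ℝ≥0∞} (hf : Measurable f) :
    ∫⁻ x, (∫⋯∫⁻_s, f ∂μ) x ∂Measure.pi μ = ∫⁻ x, f x ∂Measure.pi μ :=
  lintegral_eq_of_lmarginal_eq s (hf.lmarginal μ) hf (lmarginal_lmarginal_self μ s f)

variable {μ} in
/-- THE RATIO IDENTITY behind (0.3)/(0.4) and (1.100)/(1.102): for a fibre-measurable `num`, `den` whose fibre
integral of `den` is neither `0` nor `∞` ("the densities are positive, and the integration domains … nonempty, hence
the denominators are positive", p. 176), the term `den · (∫⌈num)/(∫⌈den)` has the same FIBRE integral as `num`. [cite: Balaban1989LargeFieldI, (0.3)–(0.4) p.176] -/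
theorem lmarginal_ratio_term (s : Finset ι) {num den : (∀ i, X i) → ℝ≥0∞} (hden : Measurable den)
    (h0 : ∀ x, (∫⋯∫⁻_s, den ∂μ) x ≠ 0) (htop : ∀ x, (∫⋯∫⁻_s, den ∂μ) x ≠ ∞) :
    ∫⋯∫⁻_s, (fun V => den V * ((∫⋯∫⁻_s, num ∂μ) V / (∫⋯∫⁻_s, den ∂μ) V)) ∂μ = ∫⋯∫⁻_s, num ∂μ := by
  have hratio : IndepOf s (fun V => (∫⋯∫⁻_s, num ∂μ) V / (∫⋯∫⁻_s, den ∂μ) V) := by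
    intro x y
    simp only [indepOf_lmarginal μ s num x y, indepOf_lmarginal μ s den x y]
  have hrw : (fun V => den V * ((∫⋯∫⁻_s, num ∂μ) V / (∫⋯∫⁻_s, den ∂μ) V))
      = (fun V => (∫⋯∫⁻_s, num ∂μ) V / (∫⋯∫⁻_s, den ∂μ) V) * den := by
    ext V; simp [mul_comm]
  rw [hrw, lmarginal_mul_of_indepOf s hratio hden]
  ext x
  simp only [Pi.mul_apply]
  exact ENNReal.div_mul_cancel (h0 x) (htop x)


variable {μ} in
/-- The general NORMALIZED-TERM identity (the shape of every factor of (1.100) p. 201: a new small-field expression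
`den` at the field, divided by its own fibre integral `∫dV′⌈_{Λ_i} den`, times an expression `N` already integrated over
(hence independent of) the fibre variables): its fibre integral is `N`. [cite: Balaban1989LargeFieldI, (1.100) p.201] -/
theorem lmarginal_norm_term (s : Finset ι) {N den : (∀ i, X i) → ℝ≥0∞} (hN : IndepOf s N) (hden : Measurable den)
    (h0 : ∀ x, (∫⋯∫⁻_s, den ∂μ) x ≠ 0) (htop : ∀ x, (∫⋯∫⁻_s, den ∂μ) x ≠ ∞) :
    ∫⋯∫⁻_s, (fun V => den V * (N V / (∫⋯∫⁻_s, den ∂μ) V)) ∂μ = N := by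
  have hratio : IndepOf s (fun V => N V / (∫⋯∫⁻_s, den ∂μ) V) := by
    intro x y
    simp only [hN x y, indepOf_lmarginal μ s den x y]
  have hrw : (fun V => den V * (N V / (∫⋯∫⁻_s, den ∂μ) V)) = (fun V => N V / (∫⋯∫⁻_s, den ∂μ) V) * den := by
    ext V; simp [mul_comm]
  rw [hrw, lmarginal_mul_of_indepOf s hratio hden]
  ext x
  simp only [Pi.mul_apply]
  exact ENNReal.div_mul_cancel (h0 x) (htop x)

/-- **(0.3)** p. 176, verbatim: *"(ℝρ)(V) = Σ_Z ρ(Z″, V) ∫dV⌈_{Z′}ρ(Z, V) / ∫dV⌈_{Z′}ρ(Z″, V)."* — CONCRETE model: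
`piece Z` = the term `ρ(Z, ·)` of (0.2) (a function of ALL variables), `pp Z` = the region `Z″` (so `piece (pp Z)` =
`ρ(Z″, ·)`), `fib Z` = the finite set `Z′` of bond variables integrated out, `∫dV⌈_{Z′}` = `lmarginal`.  Values in
`ℝ≥0∞` (densities are nonnegative; real-valued version `RopReal` below). [cite: Balaban1989LargeFieldI, (0.3) p.176] -/
noncomputable def Rop03 {R : Type*} [Fintype R] (piece : R → (∀ i, X i) → ℝ≥0∞) (pp : R → R)
    (fib : R → Finset ι) : (∀ i, X i) → ℝ≥0∞ :=
  fun V => ∑ Z, piece (pp Z) V * ((∫⋯∫⁻_(fib Z), piece Z ∂μ) V / (∫⋯∫⁻_(fib Z), piece (pp Z) ∂μ) V)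

/-- Measurability of one term of (0.3). [folklore] -/
theorem measurable_rop03_term [∀ i, SigmaFinite (μ i)] (s : Finset ι) {num den : (∀ i, X i) → ℝ≥0∞}
    (hnum : Measurable num) (hden : Measurable den) :
    Measurable (fun V => den V * ((∫⋯∫⁻_s, num ∂μ) V / (∫⋯∫⁻_s, den ∂μ) V)) :=
  hden.mul ((hnum.lmarginal μ).div (hden.lmarginal μ))

/-- **(0.4)** p. 176, verbatim: *"It satisfies the basic normalization property ∫dV(𝐑ρ)(V) = ∫dVρ(V)."* — PROVED for
the concrete model (0.3) under the printed provisos made explicit: every piece measurable, every denominator fibre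
integral `≠ 0` and `≠ ∞`.  Proof = the paper's mechanism: fibrewise the `Z`-term of (0.3) integrates to
`∫dV⌈_{Z′}ρ(Z,·)` (`lmarginal_ratio_term`), fibre integrals determine total integrals
(`lintegral_eq_of_lmarginal_eq`), and the sum is finite. [cite: Balaban1989LargeFieldI, (0.4) p.176] -/
theorem lintegral_rop03 [Fintype ι] [∀ i, SigmaFinite (μ i)] {R : Type*} [Fintype R]
    (piece : R → (∀ i, X i) → ℝ≥0∞) (pp : R → R) (fib : R → Finset ι)
    (hmeas : ∀ Z, Measurable (piece Z))
    (h0 : ∀ Z x, (∫⋯∫⁻_(fib Z), piece (pp Z) ∂μ) x ≠ 0)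
    (htop : ∀ Z x, (∫⋯∫⁻_(fib Z), piece (pp Z) ∂μ) x ≠ ∞) :
    ∫⁻ V, Rop03 μ piece pp fib V ∂Measure.pi μ = ∫⁻ V, ∑ Z, piece Z V ∂Measure.pi μ := by
  simp only [Rop03]
  rw [lintegral_finsetSum _ (fun Z _ => measurable_rop03_term μ (fib Z) (hmeas Z) (hmeas (pp Z))),
    lintegral_finsetSum _ (fun Z _ => hmeas Z)]
  refine Finset.sum_congr rfl (fun Z _ => ?_)
  exact lintegral_eq_of_lmarginal_eq (fib Z) (measurable_rop03_term μ (fib Z) (hmeas Z) (hmeas (pp Z)))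
    (hmeas Z) (lmarginal_ratio_term (fib Z) (hmeas (pp Z)) (h0 Z) (htop Z))

/-- The same identity FIBREWISE over any finite set `t` of variables containing every `Z′` — the form in which the
large-field regions outside `t` can be held fixed ("we can consider them independently", p. 194). [cite: Balaban1989LargeFieldI, (0.4) p.176] -/
theorem lmarginal_rop03 [∀ i, SigmaFinite (μ i)] {R : Type*} [Fintype R]
    (piece : R → (∀ i, X i) → ℝ≥0∞) (pp : R → R) (fib : R → Finset ι) (t : Finset ι)
    (hsub : ∀ Z, fib Z ⊆ t) (hmeas : ∀ Z, Measurable (piece Z))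
    (h0 : ∀ Z x, (∫⋯∫⁻_(fib Z), piece (pp Z) ∂μ) x ≠ 0)
    (htop : ∀ Z x, (∫⋯∫⁻_(fib Z), piece (pp Z) ∂μ) x ≠ ∞) :
    ∫⋯∫⁻_t, Rop03 μ piece pp fib ∂μ = ∫⋯∫⁻_t, (fun V => ∑ Z, piece Z V) ∂μ := by
  have hL : ∀ Z, ∫⋯∫⁻_t, (fun V => piece (pp Z) V * ((∫⋯∫⁻_(fib Z), piece Z ∂μ) V /
      (∫⋯∫⁻_(fib Z), piece (pp Z) ∂μ) V)) ∂μ = ∫⋯∫⁻_t, piece Z ∂μ := fun Z =>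
    lmarginal_eq_of_subset (hsub Z) (measurable_rop03_term μ (fib Z) (hmeas Z) (hmeas (pp Z))) (hmeas Z)
      (lmarginal_ratio_term (fib Z) (hmeas (pp Z)) (h0 Z) (htop Z))
  ext x
  have h1 : (∫⋯∫⁻_t, Rop03 μ piece pp fib ∂μ) x = ∑ Z, (∫⋯∫⁻_t, (fun V => piece (pp Z) V *
      ((∫⋯∫⁻_(fib Z), piece Z ∂μ) V / (∫⋯∫⁻_(fib Z), piece (pp Z) ∂μ) V)) ∂μ) x := by
    simp only [lmarginal, Rop03]
    exact lintegral_finsetSum _ (fun Z _ =>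
      (measurable_rop03_term μ (fib Z) (hmeas Z) (hmeas (pp Z))).comp measurable_updateFinset)
  have h2 : (∫⋯∫⁻_t, (fun V => ∑ Z, piece Z V) ∂μ) x = ∑ Z, (∫⋯∫⁻_t, piece Z ∂μ) x := by
    simp only [lmarginal]
    exact lintegral_finsetSum _ (fun Z _ => (hmeas Z).comp measurable_updateFinset)
  rw [h1, h2]
  exact Finset.sum_congr rfl (fun Z _ => by rw [hL Z])

end Fibre

/-! ### Part A2. The same mechanism over the cell's `Setup` vocabulary: gauge fields `PBond P j → G` with the product of
the normalized Haar measures (`Setup.fieldMeasure`), real densities (`Setup.Density`), Bochner integrals — the bridge to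
`Setup.PreservesIntegral` = (0.4)/(1.102), consumed by `Step.DensityRG.integral_invariant`. -/

section SetupBridge

variable {P : Params} {j : ℕ} {G : Type*} [GaugeGroup G] [MeasurableSpace G] [HaarData G]

/-- The Haar datum of `Setup` is a probability measure (its field `isProb`, as an instance). [folklore] -/
instance haar_isProbabilityMeasure : IsProbabilityMeasure (HaarData.haar : Measure G) := HaarData.isProb

/-- `Setup.fieldMeasure` IS the finite product of the Haar measures indexed by the positive bonds (definitional). [folklore] -/
theorem fieldMeasure_eq_pi :
    fieldMeasure P j G = Measure.pi (fun _ : PBond P j => (HaarData.haar : Measure G)) := rfl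

variable [DecidableEq (PBond P j)]

/-- The paper's restricted integral `∫dV⌈_{Z′} f` of a real density over the bond variables `b ∈ Z′` (p. 176; p. 194
"integration … with respect to the field variables V_k over the domain Λ"), as a real function of the whole field
(constant in the `Z′`-variables): `toReal` of the `lmarginal` of `ofReal ∘ f`. [cite: Balaban1989LargeFieldI, (0.3) p.176] -/
noncomputable def fibreIntegral (s : Finset (PBond P j)) (f : Density P j G) : Density P j G :=
  fun V => ((∫⋯∫⁻_s, (fun U => ENNReal.ofReal (f U)) ∂(fun _ : PBond P j => (HaarData.haar : Measure G))) V).toReal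

/-- ONE normalized replacement term of (0.3) / of (1.100): `new(V) · ∫dV⌈_{Z′} old / ∫dV⌈_{Z′} new` (real division; the
printed proviso "the denominators are positive" is the hypothesis `hden` of the theorems below). [cite: Balaban1989LargeFieldI, (0.3) p.176] -/
noncomputable def normTerm (s : Finset (PBond P j)) (new old : Density P j G) : Density P j G :=
  fun V => new V * (fibreIntegral s old V / fibreIntegral s new V)

omit [GaugeGroup G] [HaarData G] [DecidableEq (PBond P j)] in
/-- `ofReal ∘ f` is measurable for a measurable real density. [folklore] -/
theorem ofReal_comp_measurable {f : Density P j G} (hf : Measurable f) :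
    Measurable (fun U : GaugeField P j G => ENNReal.ofReal (f U)) :=
  ENNReal.measurable_ofReal.comp hf

/-- A bounded density has finite fibre integrals (normalized Haar fibres). [folklore] -/
theorem lmarginal_ofReal_le (s : Finset (PBond P j)) {f : Density P j G} {C : ℝ} (hC : ∀ V, f V ≤ C)
    (V : GaugeField P j G) :
    (∫⋯∫⁻_s, (fun U => ENNReal.ofReal (f U)) ∂(fun _ : PBond P j => (HaarData.haar : Measure G))) V
      ≤ ENNReal.ofReal C := by
  have h1 : (∫⋯∫⁻_s, (fun U => ENNReal.ofReal (f U)) ∂(fun _ : PBond P j => (HaarData.haar : Measure G))) V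
      ≤ (∫⋯∫⁻_s, (fun _ => ENNReal.ofReal C) ∂(fun _ : PBond P j => (HaarData.haar : Measure G))) V :=
    lmarginal_mono (fun U => ENNReal.ofReal_le_ofReal (hC U)) V
  have h2 : (∫⋯∫⁻_s, (fun _ => ENNReal.ofReal C) ∂(fun _ : PBond P j => (HaarData.haar : Measure G)))
      = fun _ => ENNReal.ofReal C :=
    lmarginal_of_indepOf s (fun _ _ => rfl)
  rw [h2] at h1
  exact h1

/-- **(1.102) for one renormalized component**, PROVED in the concrete model: if `new`, `old` are measurable,
nonnegative, bounded densities and the fibre integral `∫dV⌈_{Z′} new` vanishes nowhere (the printed proviso, p. 176),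
then `∫dV [new · ∫dV⌈old/∫dV⌈new] = ∫dV old` over `Setup.fieldMeasure`.  This is the kernel of "the fundamental
normalization property" (1.102) p. 201 and of (0.4) p. 176. [cite: Balaban1989LargeFieldI, (1.102) p.201] -/
theorem integral_normTerm_eq (s : Finset (PBond P j)) {new old : Density P j G}
    (hnew_m : Measurable new) (hold_m : Measurable old) (hnew0 : ∀ V, 0 ≤ new V) (hold0 : ∀ V, 0 ≤ old V)
    {C : ℝ} (hnewC : ∀ V, new V ≤ C) (holdC : ∀ V, old V ≤ C)
    (hden : ∀ V, fibreIntegral s new V ≠ 0) :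
    ∫ V, normTerm s new old V ∂(fieldMeasure P j G) = ∫ V, old V ∂(fieldMeasure P j G) := by
  set μH : PBond P j → Measure G := fun _ => (HaarData.haar : Measure G) with hμH
  set Ln := ∫⋯∫⁻_s, (fun U => ENNReal.ofReal (new U)) ∂μH with hLn
  set Lo := ∫⋯∫⁻_s, (fun U => ENNReal.ofReal (old U)) ∂μH with hLo
  have hLn_top : ∀ V, Ln V ≠ ∞ := fun V =>
    ne_top_of_le_ne_top ENNReal.ofReal_ne_top (lmarginal_ofReal_le s hnewC V)
  have hLo_top : ∀ V, Lo V ≠ ∞ := fun V =>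
    ne_top_of_le_ne_top ENNReal.ofReal_ne_top (lmarginal_ofReal_le s holdC V)
  have hLn_0 : ∀ V, Ln V ≠ 0 := by
    intro V h
    apply hden V
    simp only [fibreIntegral]
    rw [← hμH, ← hLn, h, ENNReal.toReal_zero]
  have hLn_m : Measurable Ln := (ofReal_comp_measurable hnew_m).lmarginal μH
  have hLo_m : Measurable Lo := (ofReal_comp_measurable hold_m).lmarginal μH
  -- pointwise identification of `ofReal ∘ normTerm` with the `ℝ≥0∞` ratio term
  have hpt : ∀ V, ENNReal.ofReal (normTerm s new old V) = ENNReal.ofReal (new V) * (Lo V / Ln V) := by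
    intro V
    have hr : Lo V / Ln V ≠ ∞ := (ENNReal.div_lt_top (hLo_top V) (hLn_0 V)).ne
    simp only [normTerm, fibreIntegral]
    rw [← hμH, ← hLn, ← hLo, ← ENNReal.toReal_div, ENNReal.ofReal_mul (hnew0 V), ENNReal.ofReal_toReal hr]
  have hnt0 : ∀ V, 0 ≤ normTerm s new old V := fun V =>
    mul_nonneg (hnew0 V) (div_nonneg ENNReal.toReal_nonneg ENNReal.toReal_nonneg)
  have hnt_m : Measurable (normTerm s new old) := by
    have : Measurable (fun V => fibreIntegral s old V / fibreIntegral s new V) :=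
      (hLo_m.ennreal_toReal).div (hLn_m.ennreal_toReal)
    exact hnew_m.mul this
  -- the `ℝ≥0∞` integrals agree by the fibre mechanism
  have hlint : ∫⁻ V, ENNReal.ofReal (normTerm s new old V) ∂(fieldMeasure P j G)
      = ∫⁻ V, ENNReal.ofReal (old V) ∂(fieldMeasure P j G) := by
    rw [fieldMeasure_eq_pi]
    simp_rw [hpt]
    exact lintegral_eq_of_lmarginal_eq s ((ofReal_comp_measurable hnew_m).mul (hLo_m.div hLn_m))
      (ofReal_comp_measurable hold_m)
      (lmarginal_ratio_term s (ofReal_comp_measurable hnew_m) hLn_0 hLn_top)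
  rw [integral_eq_lintegral_of_nonneg_ae (Filter.Eventually.of_forall hnt0) hnt_m.aestronglyMeasurable,
    integral_eq_lintegral_of_nonneg_ae (Filter.Eventually.of_forall hold0) hold_m.aestronglyMeasurable, hlint]

/-- The normalized term is integrable (nonnegative with the finite integral of `old`). [folklore] -/
theorem integrable_normTerm (s : Finset (PBond P j)) {new old : Density P j G}
    (hnew_m : Measurable new) (hold_m : Measurable old) (hnew0 : ∀ V, 0 ≤ new V)
    {C : ℝ} (hnewC : ∀ V, new V ≤ C) (holdC : ∀ V, old V ≤ C)
    (hden : ∀ V, fibreIntegral s new V ≠ 0) :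
    Integrable (normTerm s new old) (fieldMeasure P j G) := by
  set μH : PBond P j → Measure G := fun _ => (HaarData.haar : Measure G) with hμH
  set Ln := ∫⋯∫⁻_s, (fun U => ENNReal.ofReal (new U)) ∂μH with hLn
  set Lo := ∫⋯∫⁻_s, (fun U => ENNReal.ofReal (old U)) ∂μH with hLo
  have hLn_top : ∀ V, Ln V ≠ ∞ := fun V =>
    ne_top_of_le_ne_top ENNReal.ofReal_ne_top (lmarginal_ofReal_le s hnewC V)
  have hLo_top : ∀ V, Lo V ≠ ∞ := fun V =>
    ne_top_of_le_ne_top ENNReal.ofReal_ne_top (lmarginal_ofReal_le s holdC V)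
  have hLn_0 : ∀ V, Ln V ≠ 0 := by
    intro V h
    apply hden V
    simp only [fibreIntegral]
    rw [← hμH, ← hLn, h, ENNReal.toReal_zero]
  have hLn_m : Measurable Ln := (ofReal_comp_measurable hnew_m).lmarginal μH
  have hLo_m : Measurable Lo := (ofReal_comp_measurable hold_m).lmarginal μH
  have hpt : ∀ V, ENNReal.ofReal (normTerm s new old V) = ENNReal.ofReal (new V) * (Lo V / Ln V) := by
    intro V
    have hr : Lo V / Ln V ≠ ∞ := (ENNReal.div_lt_top (hLo_top V) (hLn_0 V)).ne
    simp only [normTerm, fibreIntegral]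
    rw [← hμH, ← hLn, ← hLo, ← ENNReal.toReal_div, ENNReal.ofReal_mul (hnew0 V), ENNReal.ofReal_toReal hr]
  have hnt0 : ∀ V, 0 ≤ normTerm s new old V := fun V =>
    mul_nonneg (hnew0 V) (div_nonneg ENNReal.toReal_nonneg ENNReal.toReal_nonneg)
  have hnt_m : Measurable (normTerm s new old) := by
    have : Measurable (fun V => fibreIntegral s old V / fibreIntegral s new V) :=
      (hLo_m.ennreal_toReal).div (hLn_m.ennreal_toReal)
    exact hnew_m.mul this
  refine ⟨hnt_m.aestronglyMeasurable, ?_⟩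
  rw [hasFiniteIntegral_iff_ofReal (Filter.Eventually.of_forall hnt0)]
  simp_rw [hpt]
  have hlint : ∫⁻ V, ENNReal.ofReal (new V) * (Lo V / Ln V) ∂(fieldMeasure P j G)
      = ∫⁻ V, ENNReal.ofReal (old V) ∂(fieldMeasure P j G) :=
    lintegral_eq_of_lmarginal_eq s ((ofReal_comp_measurable hnew_m).mul (hLo_m.div hLn_m))
      (ofReal_comp_measurable hold_m)
      (lmarginal_ratio_term s (ofReal_comp_measurable hnew_m) hLn_0 hLn_top)
  rw [hlint]
  calc ∫⁻ V, ENNReal.ofReal (old V) ∂(fieldMeasure P j G)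
      ≤ ∫⁻ _V, ENNReal.ofReal C ∂(fieldMeasure P j G) :=
        lintegral_mono (fun V => ENNReal.ofReal_le_ofReal (holdC V))
    _ < ∞ := by simp

/-- **(0.3) over `Setup`**, real-valued: `(ℝρ)(V) = Σ_Z ρ(Z″,V)·∫dV⌈_{Z′}ρ(Z,V)/∫dV⌈_{Z′}ρ(Z″,V)` with `piece Z = ρ(Z,·)`,
`pp Z = Z″`, `fib Z = Z′` (a `Finset` of positive bonds of `T^{(j)}`). [cite: Balaban1989LargeFieldI, (0.3) p.176] -/
noncomputable def RopReal {R : Type*} [Fintype R] (piece : R → Density P j G) (pp : R → R)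
    (fib : R → Finset (PBond P j)) : Density P j G :=
  fun V => ∑ Z, normTerm (fib Z) (piece (pp Z)) (piece Z) V

/-- **(0.4) over `Setup`, PROVED** for the concrete (0.3): with measurable, nonnegative, uniformly bounded pieces and
nowhere-vanishing denominators, `∫dV (ℝρ)(V) = ∫dV ρ(V)` where `ρ = Σ_Z ρ(Z,·)` is (0.2) (`Setup.LargeFieldDecomp`
shape).  Value: the printed "basic normalization property" holds BY CONSTRUCTION once the provisos hold; the provisos
(positivity of the densities, non-emptiness of the integration domains) are what B15/B16 must supply. [cite: Balaban1989LargeFieldI, (0.4) p.176] -/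
theorem integral_ropReal_eq {R : Type*} [Fintype R] (piece : R → Density P j G) (pp : R → R)
    (fib : R → Finset (PBond P j)) (hm : ∀ Z, Measurable (piece Z)) (h0 : ∀ Z V, 0 ≤ piece Z V)
    {C : ℝ} (hC : ∀ Z V, piece Z V ≤ C) (hden : ∀ Z V, fibreIntegral (fib Z) (piece (pp Z)) V ≠ 0) :
    ∫ V, RopReal piece pp fib V ∂(fieldMeasure P j G) = ∫ V, ∑ Z, piece Z V ∂(fieldMeasure P j G) := by
  simp only [RopReal]
  rw [integral_finsetSum _ (fun Z _ => integrable_normTerm (fib Z) (hm (pp Z)) (hm Z) (h0 (pp Z))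
      (hC (pp Z)) (hC Z) (hden Z)),
    integral_finsetSum _ (fun Z _ => ?_)]
  · exact Finset.sum_congr rfl (fun Z _ => integral_normTerm_eq (fib Z) (hm (pp Z)) (hm Z) (h0 (pp Z)) (h0 Z)
      (hC (pp Z)) (hC Z) (hden Z))
  · refine ⟨(hm Z).aestronglyMeasurable, ?_⟩
    rw [hasFiniteIntegral_iff_ofReal (Filter.Eventually.of_forall (h0 Z))]
    calc ∫⁻ V, ENNReal.ofReal (piece Z V) ∂(fieldMeasure P j G)
        ≤ ∫⁻ _V, ENNReal.ofReal C ∂(fieldMeasure P j G) :=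
          lintegral_mono (fun V => ENNReal.ofReal_le_ofReal (hC Z V))
      _ < ∞ := by simp

omit [DecidableEq (PBond P j)] in
/-- **(1.102)** p. 201, verbatim: *"The above operation has the fundamental normalization property
∫dV_k(ℝ′ρ_k)(V_k) = ∫dV_kρ_k(V_k)."* — as a Prop about an operator `R'` on the densities of ONE lattice and ONE density
`ρ` (the GLOBAL equality of total integrals, which is all that is printed; no fibrewise or local statement is made in
B15). [cite: Balaban1989LargeFieldI, (1.102) p.201] -/
def Eq1102 (R' : Density P j G → Density P j G) (ρ : Density P j G) : Prop :=
  ∫ V, R' ρ V ∂(fieldMeasure P j G) = ∫ V, ρ V ∂(fieldMeasure P j G)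

omit [DecidableEq (PBond P j)] in
/-- `Setup.PreservesIntegral R'` is literally "(1.102) for every density" — the form consumed by
`Step.DensityRG.integral_invariant`. Bookkeeping. [folklore] -/
theorem preservesIntegral_iff_eq1102 (R' : Density P j G → Density P j G) :
    PreservesIntegral R' ↔ ∀ ρ, Eq1102 R' ρ := Iff.rfl

/-- HOW A CONSUMER DISCHARGES `PreservesIntegral` FROM THE PRINTED MECHANISM: an operator that, on each density, either
acts as the identity or acts by the concrete formula (0.3) on a representation (0.2) of that density satisfying the
provisos, preserves integrals.  (The paper defines ℝ′ only on densities carrying the representation (1.99); as an operator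
on all densities it is the identity elsewhere — a typing convention, DIVERGENCE D-b01.2.) [cite: Balaban1989LargeFieldI, (1.102) p.201] -/
theorem preservesIntegral_of_rop (R' : Density P j G → Density P j G)
    (h : ∀ ρ, R' ρ = ρ ∨ ∃ (R : Type) (_ : Fintype R) (piece : R → Density P j G) (pp : R → R)
      (fib : R → Finset (PBond P j)) (C : ℝ), (∀ Z, Measurable (piece Z)) ∧ (∀ Z V, 0 ≤ piece Z V) ∧
      (∀ Z V, piece Z V ≤ C) ∧ (∀ Z V, fibreIntegral (fib Z) (piece (pp Z)) V ≠ 0) ∧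
      (ρ = fun V => ∑ Z, piece Z V) ∧ R' ρ = RopReal piece pp fib) :
    PreservesIntegral R' := by
  intro ρ
  rcases h ρ with hid | ⟨R, _, piece, pp, fib, C, hm, h0, hC, hden, hρ, hR⟩
  · rw [hid]
  · rw [hR, integral_ropReal_eq piece pp fib hm h0 hC hden, hρ]

end SetupBridge

/-! ## Part B. Verbatim leaves of §1 (statement level; schematic real parameters — DIVERGENCE D-b01.3). -/

section Leaves

/-- **(1.24)/(1.49)**, the generic small-field line of the characteristic function `χ_k^{(n)}` (pp. 181–182, 186),
verbatim (1.49): *"|U^{(n)}_{k,Z}(∂p) − 1| < (1 − β(1 − 2^{−(j−i+1)}))L₀^{2max{0,i−k₀−1}}ε_i(L^{k−i}η)²"* for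
`p ∈ Z″_{i+1}∖Z″_i`, `i = h,…,j−1`.  Schematic reals: `dev = |U(∂p) − 1|`, `t = 2^{−(j−i+1)}`,
`L0pow = L₀^{2max{0,i−k₀−1}}`, `εE = ε_i(L^{k−i}η)²`. [cite: Balaban1989LargeFieldI, (1.49) p.186] -/
def SF149 (dev β t L0pow εE : ℝ) : Prop := dev < (1 - β * (1 - t)) * L0pow * εE

/-- **(1.24)/(1.51)**, the `(1 − β½)` lines (p. 182, p. 187), verbatim (1.51): *"|U^{(n)}_{k,Z}(∂p) − 1| <
(1 − β½)L₀^{2max{0,j−l−1}}ε_j(L^{k−j}η)²"* on `Ω_l∖Ω_{l+1}`, `l = k₀+1,…,j`, and on `Ω^c_{k₀+1}∖Z″_j` for `l = k₀`.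
[cite: Balaban1989LargeFieldI, (1.51) p.187] -/
def SF151 (dev β L0pow εE : ℝ) : Prop := dev < (1 - β / 2) * L0pow * εE

/-- **(1.48)** p. 186, verbatim: *"|U^{(n)}_{k,Z}(∂p) − 1| ≤ |U^{(n+1)}_{k,Z}(∂p) − 1|(1 + αβ2^{−(j−i)}) +
αβ2^{−(j−i)}ε_i(L^{k−i}η)² for p∈B^i(y)"* (`s = 2^{−(j−i)}`; from (1.46), (1.47) and "We choose M large enough, so that
δ(M/M₁) ≥ 2 … the absolute constant α will be chosen later"). [cite: Balaban1989LargeFieldI, (1.48) p.186] -/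
def Ineq148 (dev dev' α β s εE : ℝ) : Prop := dev ≤ dev' * (1 + α * β * s) + α * β * s * εE

/-- **(1.52)** middle/last expression, p. 187, verbatim: *"< ((1 + β₀)(1 + αβ)L₀²/L² + 2αβ/(2−β))·(1 − β½)
L₀^{2max{0,j−l−1}}ε_j(L^{k−j}η)²"* — its numerical coefficient. [cite: Balaban1989LargeFieldI, (1.52) p.187] -/
noncomputable def coeff152 (β₀ β α L₀ L : ℝ) : ℝ := (1 + β₀) * (1 + α * β) * (L₀ ^ 2 / L ^ 2) + 2 * α * β / (2 - β)

/-- **(1.29)** p. 183 — the claim that the restrictions introduced by the NEW characteristic function `χ_k^{(n)}`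
(1.24) imply the OLD small-field restrictions, printed as an equality "(new factors)·(old factors) = (new factors)"
and proved on pp. 183–187 ("This completes the proof of the equality (1.29)", p. 187).  Schematic: configurations `C`,
`new`/`old` the two conjunctions of restrictions. [cite: Balaban1989LargeFieldI, (1.29) p.183] -/
def Claim129 {C : Type*} (new old : C → Prop) : Prop := ∀ U, new U → old U

/-- The printed equality form of (1.29)/(1.89), `χ_new · χ_old = χ_new` as `{0,1}`-valued functions, is the
implication `Claim129`. Bookkeeping. [folklore] -/
theorem claim129_iff_indicator {C : Type*} (new old : C → Prop) [DecidablePred new] [DecidablePred old] :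
    Claim129 new old ↔
      ∀ U, (if new U then (1:ℝ) else 0) * (if old U then 1 else 0) = if new U then 1 else 0 := by
  constructor
  · intro h U
    by_cases hn : new U
    · simp [hn, h U hn]
    · simp [hn]
  · intro h U hn
    have := h U
    simp only [hn, if_true, one_mul] at this
    by_contra ho
    simp [ho] at this

/-- **(1.89)** p. 198, verbatim: *"χ_k(Ω_k^{∼4})χ_{k,Λ}χ_{h,1/2}((Ω″^∼_{h+1})^c∩Ω_h)χ′χ_h(Ω_h∩Z_h)χ″_k =
χ_k(Ω_k^{∼4})χ_{k,Λ}χ_{h,1/2}((Ω″^∼_{h+1})^c∩Ω_h)χ′"* — "the restrictions introduced by the remaining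
characteristic functions … imply that χ_hχ″_k = 1"; proof "sketch[ed] only [in its] main points" pp. 198–200 under
"We have assumed that β ≤ 1/4".  Same schematic shape as `Claim129`. [cite: Balaban1989LargeFieldI, (1.89) p.198] -/
def Claim189 {C : Type*} (remaining dropped : C → Prop) : Prop := Claim129 remaining dropped

/-- **(1.31)** p. 184, verbatim: *"|U_{j,□}(∂p) − 1| < (1 + (2β/10)ε_jξ)(1 − β½)ε_jξ² + (2β/10)ε_jξ²(1 + (4β/10)ε_j)
< (1 − β/2 + (2β/10)L^{−2} + 4β/10)ε_jξ² < ε_j(L^{k−j}η)² for p ⊂ □^∼"* (inputs: (3.6)–(3.8) [III], (1.65) [14],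
"B₃exp(−δ2M₂R_j)22d²ε_j < (β/10)ε_j").  The three printed expressions as reals (`e = ε_j`, `x = ξ`). [cite: Balaban1989LargeFieldI, (1.31) p.184] -/
noncomputable def expr131a (β e x : ℝ) : ℝ :=
  (1 + (2 * β / 10) * e * x) * (1 - β / 2) * e * x ^ 2 + (2 * β / 10) * e * x ^ 2 * (1 + (4 * β / 10) * e)

/-- (1.31) p. 184: the printed numerical coefficient `1 − β/2 + (2β/10)L^{−2} + 4β/10` of the middle expression.
[cite: Balaban1989LargeFieldI, (1.31) p.184] -/
noncomputable def coeff131 (β L : ℝ) : ℝ := 1 - β / 2 + (2 * β / 10) * (L ^ 2)⁻¹ + 4 * β / 10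

/-- **(1.57)** p. 188, verbatim: *"|ℍ^{(n+1)}_{k,Z}| ≤ (L^{j+1}η)^{−1}B₃exp(−δ10M(R_{j+1} + ⋯ + R_{k−1}) − δMR_k)
44d²B₃ε_k < 44d²B₃²(1 + β₀)exp(−R_j)ε_j"* (the second inequality silently uses the flow relations between `ε_k` and
`ε_j` and the monotonicity of `R`). Schematic. [cite: Balaban1989LargeFieldI, (1.57) p.188] -/
def Ineq157 (H Lpow B₃ δ M sumR Rk Rj d εk εj β₀ : ℝ) : Prop :=
  H ≤ Lpow * B₃ * Real.exp (-(δ * 10 * M * sumR) - δ * M * Rk) * (44 * d ^ 2) * B₃ * εk ∧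
    Lpow * B₃ * Real.exp (-(δ * 10 * M * sumR) - δ * M * Rk) * (44 * d ^ 2) * B₃ * εk
      < 44 * d ^ 2 * B₃ ^ 2 * (1 + β₀) * Real.exp (-Rj) * εj

/-- **(1.64)(i)** p. 190 — the numerical factor of the regularity conditions of the spaces `𝔘^{(n)c}_k(X, α₀, α₁)`,
verbatim: *"(1 − β Σ_{i=h+1}^{j} 2^{−|m−i|} − β Σ_{q=m+1}^{k} 2^{−(q−m)}) L₀^{2max{0,m−k₀}}"* — its bracket, with
the sums written over `Finset.range` (`i = h+1+n`, `q = m+1+n`). [cite: Balaban1989LargeFieldI, (1.64) p.190] -/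
noncomputable def lfFactor (β : ℝ) (h j m k : ℕ) : ℝ :=
  1 - β * ∑ n ∈ Finset.range (j - h), (1 / 2 : ℝ) ^ Int.natAbs ((m : ℤ) - (h + 1 + n : ℕ))
    - β * ∑ n ∈ Finset.range (k - m), (1 / 2 : ℝ) ^ (n + 1)

/-- **(1.83)** p. 197, verbatim: *"|V_Λ(b) − 1| < O(1)B₅M⁶ε_k for b ⊂ Λ^{(k)}"* (`C` = the unspecified `O(1)`,
which by p. 192 ll. 11–13 and p. 193 l. 15 absorbs the factor `2L₀^{2N₀} < 2L(L+1)N₀^{−1}R_k` of the input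
regularity `ε = 2L₀^{2N₀}ε_k` of Proposition 1 — cell GAPS row G-B15-07). [cite: Balaban1989LargeFieldI, (1.83) p.197] -/
def Ineq183 (dev C B₅ M εk : ℝ) : Prop := dev < C * B₅ * M ^ 6 * εk

/-- **(1.84)** p. 197, verbatim: *"|M^j(U₀) − 1| < O(1)B₃B₅M⁶ε_k inside Λ"*. [cite: Balaban1989LargeFieldI, (1.84) p.197] -/
def Ineq184 (dev C B₃ B₅ M εk : ℝ) : Prop := dev < C * B₃ * B₅ * M ^ 6 * εk

/-- **(1.87)** p. 197, verbatim: *"|𝔸₀|, |∇^η𝔸₀|, |∂^{η*}∂^η𝔸₀| < O(1)B₃²B₅M⁶ε_k on Z″_k"*. [cite: Balaban1989LargeFieldI, (1.87) p.197] -/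
def Ineq187 (a da dda C B₃ B₅ M εk : ℝ) : Prop :=
  a < C * B₃ ^ 2 * B₅ * M ^ 6 * εk ∧ da < C * B₃ ^ 2 * B₅ * M ^ 6 * εk ∧ dda < C * B₃ ^ 2 * B₅ * M ^ 6 * εk

/-- **(1.94)** p. 198, the first restriction on `N`, verbatim: *"we assume that N ≤ O(1)(log g_k^{−2})^ν ≤
O(1)(1 + β₀)(log g_h^{−2})^ν with a positive integer ν satisfying (1/2)ν ≤ p₀ − p₁ − 1"* (the second restriction —
"N has to be sufficiently large, so that the constant in the second term above can be bounded by (1/2)α" — is a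
smallness condition on `L^{−N}N^{1/2}O(1)B₃³B₅M⁶`). [cite: Balaban1989LargeFieldI, (1.94) p.198] -/
def RestrN194 (N C x ν p₀ p₁ : ℝ) : Prop := N ≤ C * x ^ ν ∧ ν / 2 ≤ p₀ - p₁ - 1

/-- **(1.96)** p. 199, verbatim: *"|U″_{k,Z}(∂p) − 1| < (3/4)ε_h(L^{k−h}η)² < (1 − β(1 − 2^{−(k−h+1)}))ε_h(L^{k−h}η)²"*
("We have chosen α = 1/12 in (1.91), (1.94), (1.95)"). [cite: Balaban1989LargeFieldI, (1.96) p.199] -/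
def Ineq196 (dev β t εE : ℝ) : Prop := dev < 3 / 4 * εE ∧ 3 / 4 * εE < (1 - β * (1 - t)) * εE

/-- **(1.98)** p. 200, first line, verbatim: *"|U″_{k,Z}(∂p) − 1| < (2ε_kη² + O(1)B₃B₅M⁵exp(−δdist(p,Λ))ε_kη²)
(1 + L^{−j}αε_j)² + (2 + L^{−j}αε_j)(α + 8α²ε_j)ε_j(L^{k−j}η)²"*; for `m = k − 1` the text bounds the right side by
`(21/8)ε_kη²` after "Making [the O(1)-term] smaller than α, and taking α ≤ 1/8".  Schematic (`u = L^{−j}αε_j`,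
`X` = the `O(1)`-term, everything in units of `ε_kη²`). [cite: Balaban1989LargeFieldI, (1.98) p.200] -/
noncomputable def expr198 (α u X ε : ℝ) : ℝ := (2 + X) * (1 + u) ^ 2 + (2 + u) * (α + 8 * α ^ 2 * ε)

/-- **(1.101)** p. 201, verbatim: *"χ(Λ_i) = χ({|(1/i) log V′(b)| < M₀ε_k for b ∈ Λ_i})"* (`logV' b` = the size of
`(1/i) log V′(b)`). [cite: Balaban1989LargeFieldI, (1.101) p.201] -/
def Chi101 {B : Type*} (logV' : B → ℝ) (Λ : Set B) (M₀ εk : ℝ) : Prop := ∀ b ∈ Λ, logV' b < M₀ * εk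

/-- p. 201, verbatim: *"Then N_i = 1/(2^d d!)"* (the averaging weight over coordinate permutations and reflections in
(1.100)). [cite: Balaban1989LargeFieldI, (1.100) p.201] -/
def Nwt (d : ℕ) : ℚ := 1 / (2 ^ d * d.factorial)

/-- In `d = 4`: `N_i = 1/384`. [folklore] -/
theorem nwt_four : Nwt 4 = 1 / 384 := by norm_num [Nwt, Nat.factorial]

end Leaves

/-! ## Part C. Kernel-checked arithmetic of the printed chains (each also reproduced in exact rational arithmetic,
HOME/b2b-balaban-b01/arith-check.py; census rows C-B15-nn). -/

section Arithmetic

/-- (1.31) p. 184: the printed coefficient is `< 1` for EVERY `β > 0` as soon as `L ≥ 2` (indeed iff `L² > 2`):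
`1 − β/2 + (2β/10)L^{−2} + 4β/10 < 1`. [cite: Balaban1989LargeFieldI, (1.31) p.184] -/
theorem coeff131_lt_one {β L : ℝ} (hβ : 0 < β) (hL : 2 ≤ L) : coeff131 β L < 1 := by
  unfold coeff131
  have hL2 : (4 : ℝ) ≤ L ^ 2 := by nlinarith
  have hinv : (L ^ 2)⁻¹ ≤ 1 / 4 := by
    rw [one_div]; exact inv_anti₀ (by norm_num) hL2
  nlinarith

/-- (1.31) p. 184, middle inequality: `(1 + (2β/10)εξ)(1 − β½)εξ² + (2β/10)εξ²(1 + (4β/10)ε) ≤ (1 − β/2 +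
(2β/10)L^{−2} + 4β/10)εξ²` under `0 ≤ β ≤ 1`, `0 ≤ ε ≤ 1`, `0 ≤ ξ` and the (implicit, unprinted) smallness
`εξ ≤ L^{−2}` — census row C-B15-03 records this reading. [cite: Balaban1989LargeFieldI, (1.31) p.184] -/
theorem expr131a_le {β e x L : ℝ} (hβ0 : 0 ≤ β) (hβ1 : β ≤ 1) (he0 : 0 ≤ e) (he1 : e ≤ 1) (hx : 0 ≤ x)
    (hex : e * x ≤ (L ^ 2)⁻¹) : expr131a β e x ≤ coeff131 β L * (e * x ^ 2) := by
  unfold expr131a coeff131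
  have hbr : (1 + (2 * β / 10) * e * x) * (1 - β / 2) + (2 * β / 10) * (1 + (4 * β / 10) * e)
      ≤ 1 - β / 2 + (2 * β / 10) * (L ^ 2)⁻¹ + 4 * β / 10 := by
    have hex' : e * x * (1 - β / 2) ≤ (L ^ 2)⁻¹ :=
      (mul_le_of_le_one_right (mul_nonneg he0 hx) (by linarith)).trans hex
    have h1 : (2 * β / 10) * (e * x * (1 - β / 2)) ≤ (2 * β / 10) * (L ^ 2)⁻¹ :=
      mul_le_mul_of_nonneg_left hex' (by positivity)
    have hβe : β * e ≤ 1 := by nlinarith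
    have h2 : β * (β * e) ≤ β * 1 := mul_le_mul_of_nonneg_left hβe hβ0
    have expand : (1 + (2 * β / 10) * e * x) * (1 - β / 2) + (2 * β / 10) * (1 + (4 * β / 10) * e)
        = (1 - β / 2) + (2 * β / 10) * (e * x * (1 - β / 2)) + 2 * β / 10 + (8 / 100) * (β * (β * e)) := by
      ring
    rw [expand]
    linarith
  have hex2 : 0 ≤ e * x ^ 2 := by positivity
  calc (1 + (2 * β / 10) * e * x) * (1 - β / 2) * e * x ^ 2 + (2 * β / 10) * e * x ^ 2 * (1 + (4 * β / 10) * e)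
      = ((1 + (2 * β / 10) * e * x) * (1 - β / 2) + (2 * β / 10) * (1 + (4 * β / 10) * e)) * (e * x ^ 2) := by
        ring
    _ ≤ (1 - β / 2 + (2 * β / 10) * (L ^ 2)⁻¹ + 4 * β / 10) * (e * x ^ 2) :=
        mul_le_mul_of_nonneg_right hbr hex2

/-- p. 186, after (1.47): *"We choose M large enough, so that δ(M/M₁) ≥ 2. Then the product of 1 + (j−i)^{1/2} and
the exponential factor in (1.47) can be estimated by exp(−(j−i))"* — `(1 + √n)·e^{−2n} ≤ e^{−n}` for `n ≥ 1`
(via `1 + √n ≤ 1 + n ≤ eⁿ`); the further `e^{−n} ≤ 2^{−n}` giving the `2^{−(j−i)}` of (1.48) is the landed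
`Literature.Barriers.CriticalPhenomena.AxisProfileNoDoubling.exp_neg_nat_le_half_pow` (not re-proved here).
[cite: Balaban1989LargeFieldI, (1.47) p.186] -/
theorem sqrt_exp_estimate {n : ℝ} (hn : 1 ≤ n) :
    (1 + Real.sqrt n) * Real.exp (-(2 * n)) ≤ Real.exp (-n) := by
  have hs : Real.sqrt n ≤ n := by
    calc Real.sqrt n ≤ Real.sqrt (n ^ 2) := Real.sqrt_le_sqrt (by nlinarith)
      _ = n := Real.sqrt_sq (by linarith)
  have h1 : 1 + Real.sqrt n ≤ Real.exp n := by linarith [Real.add_one_le_exp n]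
  have h2 : Real.exp (-(2 * n)) = Real.exp (-n) * Real.exp (-n) := by
    rw [← Real.exp_add]; ring_nf
  rw [h2]
  calc (1 + Real.sqrt n) * (Real.exp (-n) * Real.exp (-n))
      = ((1 + Real.sqrt n) * Real.exp (-n)) * Real.exp (-n) := by ring
    _ ≤ (Real.exp n * Real.exp (-n)) * Real.exp (-n) := by
        gcongr
    _ = Real.exp (-n) := by rw [← Real.exp_add]; simp

/-- (1.50) p. 187, PROVED: from (1.48) and the inductive hypothesis (1.49) at level `n+1` (there `j+1` replaces
`j`, so `2^{−(j+1−i+1)} = s/4` with `s = 2^{−(j−i)}`), the deviation at level `n` satisfies the LAST bound of (1.50),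
whose coefficient is `1 − β(1 − s/4) + 2αβs` (`= 1 − β(1 − 2^{−(j−i+1)}) − β2^{−(j−i+2)} + 2αβ2^{−(j−i)}`, see
`coeff150_eq`); uses `L0pow ≥ 1`, `0 ≤ β ≤ 1`, `0 ≤ s ≤ 1`, `α ≥ 0`. [cite: Balaban1989LargeFieldI, (1.50) p.187] -/
theorem ineq150 {dev dev' α β s P E : ℝ} (hα : 0 ≤ α) (hβ0 : 0 ≤ β) (hβ1 : β ≤ 1) (hs0 : 0 ≤ s) (hs1 : s ≤ 1)
    (hP : 1 ≤ P) (hE : 0 ≤ E) (h148 : Ineq148 dev dev' α β s E)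
    (h149 : SF149 dev' β (s / 4) P E) : dev < (1 - β * (1 - s / 4) + 2 * α * β * s) * P * E := by
  unfold Ineq148 at h148
  unfold SF149 at h149
  have hc0 : 0 ≤ 1 - β * (1 - s / 4) := by nlinarith
  have hc1 : 1 - β * (1 - s / 4) ≤ 1 := by nlinarith
  have hpos : 0 < 1 + α * β * s := by positivity
  have h1 : dev' * (1 + α * β * s) < (1 - β * (1 - s / 4)) * P * E * (1 + α * β * s) :=
    mul_lt_mul_of_pos_right h149 hpos
  have hM : 0 ≤ α * β * s * P * E := by positivity
  have h3 : (1 - β * (1 - s / 4)) * (α * β * s * P * E) ≤ α * β * s * P * E := by nlinarith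
  have h4 : α * β * s * E ≤ α * β * s * P * E := by
    have : 0 ≤ α * β * s * E := by positivity
    nlinarith
  calc dev ≤ dev' * (1 + α * β * s) + α * β * s * E := h148
    _ < (1 - β * (1 - s / 4)) * P * E * (1 + α * β * s) + α * β * s * P * E := by linarith
    _ = (1 - β * (1 - s / 4)) * P * E + (1 - β * (1 - s / 4)) * (α * β * s * P * E) + α * β * s * P * E := by
        ring
    _ ≤ (1 - β * (1 - s / 4)) * P * E + α * β * s * P * E + α * β * s * P * E := by linarith
    _ = (1 - β * (1 - s / 4) + 2 * α * β * s) * P * E := by ring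

/-- The two printed forms of the (1.50) coefficient agree: `1 − β(1 − 2^{−(j−i+1)}) − β2^{−(j−i+2)} + 2αβ2^{−(j−i)}
= 1 − β(1 − s/4) + 2αβs` with `s = 2^{−(j−i)}`. [cite: Balaban1989LargeFieldI, (1.50) p.187] -/
theorem coeff150_eq (α β s : ℝ) :
    1 - β * (1 - s / 2) - β * (s / 4) + 2 * α * β * s = 1 - β * (1 - s / 4) + 2 * α * β * s := by ring

/-- (1.50) ⇒ (1.49), p. 187, verbatim: *"and the last inequality implies (1.49) if 8α ≤ 1"* — PROVED, and sharp: for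
`β > 0`, `s > 0` the (1.50) coefficient is `≤` the (1.49) coefficient `1 − β(1 − s/2)` IFF `α ≤ 1/8`. [cite: Balaban1989LargeFieldI, (1.50) p.187] -/
theorem coeff150_le_coeff149_iff {α β s : ℝ} (hβ : 0 < β) (hs : 0 < s) :
    1 - β * (1 - s / 4) + 2 * α * β * s ≤ 1 - β * (1 - s / 2) ↔ α ≤ 1 / 8 := by
  have hβs : 0 < β * s := mul_pos hβ hs
  constructor
  · intro h; nlinarith
  · intro h; nlinarith

/-- (1.49) at level `n` from (1.48), (1.49) at level `n+1` and `8α ≤ 1` — the inductive step of the proof of (1.29)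
on `Z″_{i+1}∖Z″_i`, assembled. [cite: Balaban1989LargeFieldI, (1.50) p.187] -/
theorem sf149_step {dev dev' α β s P E : ℝ} (hα : 0 ≤ α) (hα8 : α ≤ 1 / 8) (hβ0 : 0 ≤ β) (hβ1 : β ≤ 1)
    (hs0 : 0 ≤ s) (hs1 : s ≤ 1) (hP : 1 ≤ P) (hE : 0 ≤ E) (h148 : Ineq148 dev dev' α β s E)
    (h149 : SF149 dev' β (s / 4) P E) : SF149 dev β (s / 2) P E := by
  unfold SF149
  have h := ineq150 hα hβ0 hβ1 hs0 hs1 hP hE h148 h149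
  have hPE : 0 ≤ P * E := by positivity
  have hc : (1 - β * (1 - s / 4) + 2 * α * β * s) * P * E ≤ (1 - β * (1 - s / 2)) * P * E := by
    have hβs : 0 ≤ β * s := mul_nonneg hβ0 hs0
    have hkey : α * (β * s) ≤ 1 / 8 * (β * s) := mul_le_mul_of_nonneg_right hα8 hβs
    have : 1 - β * (1 - s / 4) + 2 * α * β * s ≤ 1 - β * (1 - s / 2) := by nlinarith [hkey]
    calc (1 - β * (1 - s / 4) + 2 * α * β * s) * P * E = (1 - β * (1 - s / 4) + 2 * α * β * s) * (P * E) := by ring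
      _ ≤ (1 - β * (1 - s / 2)) * (P * E) := mul_le_mul_of_nonneg_right this hPE
      _ = (1 - β * (1 - s / 2)) * P * E := by ring
  exact lt_of_lt_of_le h hc

/-- (1.52) ⇒ (1.51), p. 187, verbatim: *"The above inequality implies (1.51), under the usual restrictions on β₀, β,
L₀ (i.e., β₀ ≤ 1/2, β ≤ 1/2, L₀ < (1/2)L), and α ≤ 1/4"* — PROVED: the coefficient is `< 1` (indeed `≤ 113/192`).
[cite: Balaban1989LargeFieldI, (1.52) p.187] -/
theorem coeff152_lt_one {β₀ β α L₀ L : ℝ} (hβ₀0 : 0 ≤ β₀) (hβ₀ : β₀ ≤ 1 / 2) (hβ0 : 0 ≤ β) (hβ : β ≤ 1 / 2)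
    (hα0 : 0 ≤ α) (hα : α ≤ 1 / 4) (hL₀ : 0 ≤ L₀) (hL : 0 < L) (hL₀L : L₀ < L / 2) :
    coeff152 β₀ β α L₀ L < 1 := by
  unfold coeff152
  have hq : L₀ ^ 2 / L ^ 2 < 1 / 4 := by
    rw [div_lt_iff₀ (by positivity)]
    nlinarith
  have hq0 : 0 ≤ L₀ ^ 2 / L ^ 2 := by positivity
  have hab : α * β ≤ 1 / 4 * (1 / 2) := mul_le_mul hα hβ hβ0 (by norm_num)
  have hf : (1 + β₀) * (1 + α * β) ≤ 3 / 2 * (9 / 8) :=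
    mul_le_mul (by linarith) (by linarith) (by positivity) (by norm_num)
  have hf0 : 0 ≤ (1 + β₀) * (1 + α * β) := by positivity
  have h1 : (1 + β₀) * (1 + α * β) * (L₀ ^ 2 / L ^ 2) ≤ 3 / 2 * (9 / 8) * (L₀ ^ 2 / L ^ 2) :=
    mul_le_mul_of_nonneg_right hf hq0
  have h2 : 2 * α * β / (2 - β) ≤ 1 / 6 := by
    rw [div_le_iff₀ (by linarith)]
    nlinarith
  nlinarith

/-- (1.52) middle step, p. 187, PROVED from the flow input `ε_{j+1} ≤ (1+β₀)ε_j` ([III] Sect. 2), `L₀^{2max{0,j−l}} ≤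
L₀²·L₀^{2max{0,j−l−1}}`, `L₀^{2max{0,j−l−1}} ≥ 1`, `(L^{k−j−1}η)² = L^{−2}(L^{k−j}η)²` and `2αβ/(2−β)·(1−β½) = αβ`:
`(1−β½)Q′ε′(W/L²)(1+αβ) + αβεW ≤ coeff152·(1−β½)QεW`. [cite: Balaban1989LargeFieldI, (1.52) p.187] -/
theorem ineq152_middle {β₀ β α L₀ L Q Q' ε ε' W : ℝ} (hβ0 : 0 ≤ β) (hβ : β < 2) (hα0 : 0 ≤ α) (hβ₀0 : 0 ≤ β₀)
    (hL : 0 < L) (hQ : 1 ≤ Q) (hQ' : Q' ≤ L₀ ^ 2 * Q) (hε : 0 ≤ ε) (hε' : ε' ≤ (1 + β₀) * ε)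
    (hε'0 : 0 ≤ ε') (hW : 0 ≤ W) :
    (1 - β / 2) * Q' * ε' * (W / L ^ 2) * (1 + α * β) + α * β * ε * W
      ≤ coeff152 β₀ β α L₀ L * ((1 - β / 2) * Q * ε * W) := by
  unfold coeff152
  have hb : 0 < 1 - β / 2 := by linarith
  have hsecond : 2 * α * β / (2 - β) * ((1 - β / 2) * Q * ε * W) = α * β * (Q * ε * W) := by
    have : (2 - β) ≠ 0 := by linarith
    rw [div_mul_eq_mul_div, div_eq_iff this]
    ring
  have hfirst : (1 - β / 2) * Q' * ε' * (W / L ^ 2) * (1 + α * β)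
      ≤ (1 + β₀) * (1 + α * β) * (L₀ ^ 2 / L ^ 2) * ((1 - β / 2) * Q * ε * W) := by
    have hQε : Q' * ε' ≤ L₀ ^ 2 * Q * ((1 + β₀) * ε) :=
      mul_le_mul hQ' hε' hε'0 (by positivity)
    have hrest : 0 ≤ (1 - β / 2) * (W / L ^ 2) * (1 + α * β) := by positivity
    calc (1 - β / 2) * Q' * ε' * (W / L ^ 2) * (1 + α * β)
        = (Q' * ε') * ((1 - β / 2) * (W / L ^ 2) * (1 + α * β)) := by ring
      _ ≤ (L₀ ^ 2 * Q * ((1 + β₀) * ε)) * ((1 - β / 2) * (W / L ^ 2) * (1 + α * β)) :=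
          mul_le_mul_of_nonneg_right hQε hrest
      _ = (1 + β₀) * (1 + α * β) * (L₀ ^ 2 / L ^ 2) * ((1 - β / 2) * Q * ε * W) := by
          field_simp
  have hthird : α * β * ε * W ≤ α * β * (Q * ε * W) := by
    have : 0 ≤ α * β * ε * W := by positivity
    nlinarith
  rw [add_mul, hsecond]
  linarith

/-- (1.43) p. 185: `2δ′_j + ½δ_j < 2δ_j` iff `δ′_j < ¾δ_j` (the printed chain needs `δ′_j = (p₁(g_j)/p₀(g_j))δ_j` with
`p₁/p₀ < 3/4`, true for `g_j` small since `p₁ < p₀`). [cite: Balaban1989LargeFieldI, (1.43) p.185] -/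
theorem ineq143_iff (δ δ' : ℝ) : 2 * δ' + δ / 2 < 2 * δ ↔ δ' < 3 / 4 * δ := by
  constructor <;> intro h <;> linarith

/-- Finite geometric tail: `Σ_{n<N} (1/2)^{n+1} = 1 − (1/2)^N < 1` — the second sum of the (1.64)(i) factor is `< 1`
for every range. [folklore] -/
theorem sum_half_pow_succ_lt_one (N : ℕ) : ∑ n ∈ Finset.range N, (1 / 2 : ℝ) ^ (n + 1) < 1 := by
  have h : ∑ n ∈ Finset.range N, (1 / 2 : ℝ) ^ (n + 1) = 1 - (1 / 2) ^ N := by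
    induction N with
    | zero => simp
    | succ N ih => rw [Finset.sum_range_succ, ih]; ring
  rw [h]
  have : (0 : ℝ) < (1 / 2) ^ N := by positivity
  linarith

/-- PARAMETER INCONSISTENCY WITNESS (p. 182 "0 < β ≤ 1/2 … e.g. β = 1/2" versus (1.64)(i) p. 190 / p. 191 "if β ≤ 1/4"
/ p. 198 "We have assumed that β ≤ 1/4"): at `β = 1/2` the (1.64)(i) factor is NEGATIVE for an interior index, e.g.
`(h, j, m, k) = (0, 4, 2, 5)`: `1 − ½(½ + 1 + ½ + ¼) − ½(½ + ¼ + ⅛) = −9/16`, so the regularity condition `|…| < factor·…`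
is unsatisfiable there; at `β = 1/4` the same factor is `7/32 > 0`.  Census row G-B15-02. [cite: Balaban1989LargeFieldI, (1.64) p.190] -/
theorem lfFactor_witness : lfFactor (1 / 2) 0 4 2 5 = -9 / 16 ∧ lfFactor (1 / 4) 0 4 2 5 = 7 / 32 := by
  constructor <;> (simp [lfFactor, Finset.sum_range_succ]; norm_num)

/-- … and the example `L₀ = (L−1)/2` of p. 182 violates the later restriction `L₀² ≤ (1/3)L` (p. 191, p. 192) for
every `L ≥ 4` (while `2 ≤ L₀`, `L₀² ≤ L/3` force `L ≥ 12`).  Census row G-B15-02. [cite: Balaban1989LargeFieldI, p.191] -/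
theorem l0_example_violates {L : ℝ} (hL : 4 ≤ L) : ¬ ((L - 1) / 2) ^ 2 ≤ L / 3 := by
  intro h; nlinarith

/-- A consistent instance of all printed parameter restrictions: `β = 1/4`, `β₀ = 1/2`, `L₀ = 2`, `L = 13` (odd, as in
`Setup.Params`), `α = 1/12 ≤ 1/8`: `0 < β ≤ 1/4`, `2 ≤ L₀ < L/2`, `L₀² ≤ L/3`, `8α ≤ 1`. [folklore] -/
theorem params_instance :
    (0 : ℝ) < 1 / 4 ∧ (1 / 4 : ℝ) ≤ 1 / 4 ∧ (2 : ℝ) ≤ 2 ∧ (2 : ℝ) < 13 / 2 ∧ (2 : ℝ) ^ 2 ≤ 13 / 3 ∧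
      8 * (1 / 12 : ℝ) ≤ 1 := by norm_num

/-- p. 192: *"δ′_j ≤ (1 + β₀)²(k−j)^{β₀}δ′_k ≤ (1 + β₀)²N₀^{β₀}δ′_k, so N₀δ′_j ≤ (1 + β₀)²N₀^{1+β₀}δ′_k < 4N₀²δ′_k"* —
the last step, PROVED for `0 ≤ β₀ ≤ 1/2`, `N₀ ≥ 1`. [cite: Balaban1989LargeFieldI, p.192] -/
theorem n0_delta_bound {β₀ N₀ : ℝ} (hβ₀0 : 0 ≤ β₀) (hβ₀ : β₀ ≤ 1 / 2) (hN : 1 ≤ N₀) :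
    (1 + β₀) ^ 2 * N₀ ^ (1 + β₀) < 4 * N₀ ^ 2 := by
  have h1 : (1 + β₀) ^ 2 ≤ 9 / 4 := by nlinarith
  have h2 : N₀ ^ (1 + β₀) ≤ N₀ ^ (2 : ℝ) :=
    Real.rpow_le_rpow_of_exponent_le hN (by linarith)
  have h3 : N₀ ^ (2 : ℝ) = N₀ ^ 2 := by norm_cast
  rw [h3] at h2
  have h4 : 0 < N₀ ^ 2 := by positivity
  have h5 : 0 ≤ N₀ ^ (1 + β₀) := by positivity
  have h6 : (1 + β₀) ^ 2 * N₀ ^ (1 + β₀) ≤ 9 / 4 * N₀ ^ 2 := mul_le_mul h1 h2 h5 (by norm_num)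
  linarith

/-- p. 192: *"L₀^{2N₀} ≤ (1/3)^{N₀}L(L+1)(N₀+1)^{β₀}R_k < L(L+1)N₀^{−1}R_k"* — the last step amounts to
`N₀(N₀+1)^{β₀} < 3^{N₀}`; PROVED in the form `N₀(N₀+1) < 3^{N₀}` (`N₀ ≥ 1`), which suffices since `β₀ ≤ 1`.
[cite: Balaban1989LargeFieldI, p.192] -/
theorem n0_growth (N : ℕ) (hN : 1 ≤ N) : N * (N + 1) < 3 ^ N := by
  induction N with
  | zero => omega
  | succ n ih =>
    rcases Nat.lt_or_ge n 1 with h | h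
    · interval_cases n; norm_num
    · have := ih h
      have h3 : 3 ^ (n + 1) = 3 * 3 ^ n := by ring
      nlinarith

/-- (1.96) p. 199: `3/4 < 1 − β(1 − t)` for `β ≤ 1/4` and `0 < t ≤ 1` (`t = 2^{−(k−h+1)}`) — "We have assumed that
β ≤ 1/4" (p. 198) is exactly what this needs. [cite: Balaban1989LargeFieldI, (1.96) p.199] -/
theorem coeff196 {β t : ℝ} (hβ : β ≤ 1 / 4) (ht : 0 < t) (ht1 : t ≤ 1) :
    3 / 4 < 1 - β * (1 - t) := by nlinarith

/-- p. 200, the case `m = k − 1` of (1.98): with the `O(1)`-term `X ≤ α`, `α ≤ 1/8` and the (unprinted, implicit)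
smallness `u = L^{−j}αε_j ≤ 1/100`, `ε_j ≤ 1/10`, the right side of (1.98) in units of `ε_kη²` is `≤ 21/8`. [cite: Balaban1989LargeFieldI, (1.98) p.200] -/
theorem expr198_le {α u X ε : ℝ} (hα0 : 0 ≤ α) (hα : α ≤ 1 / 8) (hu0 : 0 ≤ u) (hu : u ≤ 1 / 100)
    (hX : X ≤ α) (hε0 : 0 ≤ ε) (hε : ε ≤ 1 / 10) : expr198 α u X ε ≤ 21 / 8 := by
  unfold expr198
  have h1 : (2 + X) * (1 + u) ^ 2 ≤ (17 / 8) * (101 / 100) ^ 2 := by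
    apply mul_le_mul (by linarith) _ (by positivity) (by norm_num)
    nlinarith
  have hα2 : α ^ 2 * ε ≤ (1 / 64) * (1 / 10) := by
    apply mul_le_mul _ hε hε0 (by norm_num)
    nlinarith
  have h2 : (2 + u) * (α + 8 * α ^ 2 * ε) ≤ (201 / 100) * (11 / 80) := by
    apply mul_le_mul (by linarith) (by linarith) (by positivity) (by norm_num)
  linarith

/-- p. 200: *"(21/8)ε_kη² ≤ 3(1 − β½)ε_kη² for m = k−1"* — holds iff `β ≤ 1/4` (equality at `β = 1/4`). [cite: Balaban1989LargeFieldI, p.200] -/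
theorem bound200a {β : ℝ} : (21 / 8 : ℝ) ≤ 3 * (1 - β / 2) ↔ β ≤ 1 / 4 := by
  constructor <;> intro h <;> linarith

/-- p. 200: *"(21/8)ε_kη² ≤ (1 − β½)L₀^{2(k−m−1)}ε_kη² for the remaining m"* (`k − m − 1 ≥ 1`), for `β ≤ 1/4`,
`L₀ ≥ 2`. [cite: Balaban1989LargeFieldI, p.200] -/
theorem bound200b {β L₀ : ℝ} {n : ℕ} (hβ : β ≤ 1 / 4) (hL₀ : 2 ≤ L₀) (hn : 1 ≤ n) :
    (21 / 8 : ℝ) ≤ (1 - β / 2) * L₀ ^ (2 * n) := by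
  have h4 : (4 : ℝ) ≤ L₀ ^ (2 * n) := by
    calc (4 : ℝ) = 2 ^ (2 * 1) := by norm_num
      _ ≤ 2 ^ (2 * n) := pow_le_pow_right₀ (by norm_num) (by omega)
      _ ≤ L₀ ^ (2 * n) := pow_le_pow_left₀ (by norm_num) hL₀ _
  nlinarith

/-- p. 200: *"(4α + O(1)B₃B₅M⁵L₀^{−2(k−j)})ε_j(L^{k−j}η)² ≤ (1−β)L₀^{2(j−k₀−1)}ε_j(L^{k−j}η)² if
O(1)B₃B₅M⁵L₀^{−2(N₀−1)} ≤ 1/4"* — with `α ≤ 1/8`, `β ≤ 1/4` and `L₀^{2(j−k₀−1)} ≥ 1`. [cite: Balaban1989LargeFieldI, p.200] -/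
theorem bound200c {α β X Q : ℝ} (hα : α ≤ 1 / 8) (hX : X ≤ 1 / 4) (hβ : β ≤ 1 / 4) (hQ : 1 ≤ Q) :
    4 * α + X ≤ (1 - β) * Q := by
  nlinarith

/-- (1.94) p. 198, why `(1/2)ν ≤ p₀ − p₁ − 1` is the right restriction: for `x = log g_h^{−2} ≥ 1`,
`x^{ν/2}·x^{p₁}/x^{p₀} ≤ x^{−1}` (so `N^{1/2}p₁(g_h)/p₀(g_h) = O((log g_h^{−2})^{−1})` when `N ≤ O(1)x^ν`). [cite: Balaban1989LargeFieldI, (1.94) p.198] -/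
theorem restrN194_exponent {x ν p₀ p₁ : ℝ} (hx : 1 ≤ x) (hν : ν / 2 ≤ p₀ - p₁ - 1) :
    x ^ (ν / 2) * x ^ p₁ / x ^ p₀ ≤ x ^ (-1 : ℝ) := by
  have hx0 : 0 < x := by linarith
  rw [← Real.rpow_add hx0, div_eq_mul_inv, ← Real.rpow_neg hx0.le, ← Real.rpow_add hx0]
  exact Real.rpow_le_rpow_of_exponent_le hx (by linarith)

end Arithmetic

end Literature.MathematicalPhysics.QuantumFieldTheory.Balaban1983to89.B15.BasicStep
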